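import Summits.CriticalPhenomena.PercolationContinuityZ3.Theorems.PercNearOneGluingNoHeavyLowerTailAntitheticPendantArms
import HarnessLib

/-!
# `NoHeavyLowerTail` (stmt-CriticalPhenomena-4575) — antithetic cluster pairs: PENDANT REDUCTIONS PR1/PR2 ALONG ARMS IN THE SHIFTED-BIC
# CLASS (the `𝒮_shift` re-base of …AntitheticPendantArms; prim-hp-2 gen 65, HOME/MEMO-gen65.md §2(d), §5 (P3))

Support file (`--supports stmt-CriticalPhenomena-4575`, hull-port prover `prim-hp-2`, gen 65).  No definitions, no named facts, no sorries;
standard axioms.  Notation of …AntitheticPendantArms (`X T = openCluster (T ∩ E) s`, `Y T = openCluster (Tᶜ ∩ E) s`,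
`TII_E(P, Q; K) = Σ_{T : P ∈ X, Q ∉ Y} K₁K₂(X,Y)`).  The SHIFTED-BIC class is `𝒮_shift = {K(X,Y) = F⁺(X) − F⁻(Y) : F⁻ ≤ F⁺ monotone}`
(BIC ⊂ 𝒮_shift ⊂ 𝒮 = super-odd twisted-monotone).  The identities PR1/PR2 (`Pendant.termTwo_pendant_K`, `termTwo_pendant_split_K`) shift
only the RED argument, `K ↦ K(· ∪ S(·), ·)`, which maps `F⁺(X) − F⁻(Y)` to `F⁺(X ∪ S X) − F⁻(Y)` — again in `𝒮_shift`.  Hence the two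
iterated lemmas of …AntitheticPendantArms hold with `𝒮_shift` in hypotheses AND conclusions:
* `Antithetic.Pendant.termTwo_path_nonneg_shift` — PR1 along a pendant path: `TII_E(P, z) ≥ 0` on `𝒮_shift` ⇒ `TII_{E ∪ path}(y, z) ≥ 0` on `𝒮_shift`.
* `Antithetic.Pendant.termTwo_stub_nonneg_shift` — PR2 along a pendant stub: (⊕)_shift of `E ∪ stub_j` at `y` (`j < a`) and
  `TII_E(y, Q) ≥ 0` on `𝒮_shift` ⇒ `TII_{E ∪ stub}(y, z) ≥ 0` on `𝒮_shift`.
Why it matters: `K_{2,4}` from a pole is `𝒮_shift`-⊕ but not `𝒮`-⊕ (…AntitheticK24NotOplus; kit j285856, exact) — hypotheses over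
`𝒮_shift` are strictly weaker, and they are all the degree-2 reduction ever feeds in (`F(X ∪ {x}) − F(Y)`).
[cite: VandenbergHaggstromKahn2005, §1 p. 3 (open cluster `C_s`)]
-/

noncomputable section

namespace Summit.CriticalPhenomena.PercolationContinuityZ3.Theorems

open Literature.Probability.Percolation
open scoped Classical

namespace Antithetic

namespace Pendant

variable {V : Type*} [Fintype V] {E : Set (Sym2 V)} {s : V}

section Path

variable {u : ℕ → V} {a : ℕ}
  (hfresh : ∀ i, 0 < i → i ≤ a → ∀ f ∈ E, u i ∈ f → f.IsDiag)
  (huinj : ∀ i j, i ≤ a → j ≤ a → u i = u j → i = j) (hsu : ∀ i, 0 < i → i ≤ a → s ≠ u i)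
include hfresh huinj hsu

/-- **PR1 along a pendant path, shifted-BIC class.**  `u 0 = P, …, u a = y` fresh, `z` off the path: if
`TII_E(P, z; F⁺(X) − F⁻(Y), G⁺(X) − G⁻(Y)) ≥ 0` for all monotone `F⁻ ≤ F⁺`, `G⁻ ≤ G⁺`, then the same holds for `TII_{E ∪ path_j}(u j, z)`
(`j ≤ a`). [this work] -/
theorem termTwo_path_nonneg_shift {z : V} (hzu : ∀ i, 0 < i → i ≤ a → z ≠ u i)
    (hbase : ∀ Fp Fm Gp Gm : Set V → ℝ, Monotone Fp → Monotone Fm → (∀ S, Fm S ≤ Fp S) →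
      Monotone Gp → Monotone Gm → (∀ S, Gm S ≤ Gp S) →
      0 ≤ ∑ T ∈ Finset.univ.filter (fun T : Set (Sym2 V) => u 0 ∈ openCluster (T ∩ E) s ∧ z ∉ openCluster (Tᶜ ∩ E) s),
        (Fp (openCluster (T ∩ E) s) - Fm (openCluster (Tᶜ ∩ E) s)) * (Gp (openCluster (T ∩ E) s) - Gm (openCluster (Tᶜ ∩ E) s)))
    {j : ℕ} (hj : j ≤ a) (Fp Fm Gp Gm : Set V → ℝ) (hFp : Monotone Fp) (hFm : Monotone Fm) (hF : ∀ S, Fm S ≤ Fp S)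
    (hGp : Monotone Gp) (hGm : Monotone Gm) (hG : ∀ S, Gm S ≤ Gp S) :
    0 ≤ ∑ T ∈ Finset.univ.filter (fun T : Set (Sym2 V) =>
        u j ∈ openCluster (T ∩ (E ∪ Cyc.edgeSet j u)) s ∧ z ∉ openCluster (Tᶜ ∩ (E ∪ Cyc.edgeSet j u)) s),
      (Fp (openCluster (T ∩ (E ∪ Cyc.edgeSet j u)) s) - Fm (openCluster (Tᶜ ∩ (E ∪ Cyc.edgeSet j u)) s)) *
        (Gp (openCluster (T ∩ (E ∪ Cyc.edgeSet j u)) s) - Gm (openCluster (Tᶜ ∩ (E ∪ Cyc.edgeSet j u)) s)) := by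
  induction j generalizing Fp Fm Gp Gm with
  | zero =>
    rw [Box.union_edgeSet_zero]
    exact hbase Fp Fm Gp Gm hFp hFm hF hGp hGm hG
  | succ j ih =>
    have hj' : j < a := Nat.lt_of_succ_le hj
    rw [Box.union_edgeSet_succ, termTwo_pendant_K (Box.leaf_path hfresh huinj hj')
      (fun h => absurd (huinj j (j + 1) (by omega) hj h) (by omega)) (hsu (j + 1) (Nat.succ_pos j) hj)
      (hzu (j + 1) (Nat.succ_pos j) hj) (fun A B => Fp A - Fm B) (fun A B => Gp A - Gm B)]
    refine mul_nonneg (by norm_num) ?_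
    have hFp' : Monotone (fun P : Set V => Fp (P ∪ {u (j + 1)})) :=
      fun P P' hPP' => hFp (Set.union_subset_union_left _ hPP')
    have hGp' : Monotone (fun P : Set V => Gp (P ∪ {u (j + 1)})) :=
      fun P P' hPP' => hGp (Set.union_subset_union_left _ hPP')
    exact ih (Nat.le_of_succ_le hj) (fun P => Fp (P ∪ {u (j + 1)})) Fm (fun P => Gp (P ∪ {u (j + 1)})) Gm hFp' hFm
      (fun S => (hF S).trans (hFp Set.subset_union_left)) hGp' hGm (fun S => (hG S).trans (hGp Set.subset_union_left))

/-- **PR2 along a pendant stub, shifted-BIC class.**  `u 0 = Q, …, u a = z` fresh, `y` off the stub: if `E ∪ stub_j` is ⊕-positive at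
`y` for every `j < a` and `TII_E(y, Q) ≥ 0`, both for all shifted-BIC pairs, then `TII_{E ∪ stub_j}(y, u j) ≥ 0` for all shifted-BIC pairs
(`j ≤ a`). [this work] -/
theorem termTwo_stub_nonneg_shift {y : V} (hyu : ∀ i, 0 < i → i ≤ a → y ≠ u i)
    (hoplus : ∀ j, j < a → ∀ Fp Fm Gp Gm : Set V → ℝ, Monotone Fp → Monotone Fm → (∀ S, Fm S ≤ Fp S) →
      Monotone Gp → Monotone Gm → (∀ S, Gm S ≤ Gp S) →
      0 ≤ ∑ T ∈ Finset.univ.filter (fun T : Set (Sym2 V) => y ∈ openCluster (T ∩ (E ∪ Cyc.edgeSet j u)) s),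
        (Fp (openCluster (T ∩ (E ∪ Cyc.edgeSet j u)) s) - Fm (openCluster (Tᶜ ∩ (E ∪ Cyc.edgeSet j u)) s)) *
          (Gp (openCluster (T ∩ (E ∪ Cyc.edgeSet j u)) s) - Gm (openCluster (Tᶜ ∩ (E ∪ Cyc.edgeSet j u)) s)))
    (hbase : ∀ Fp Fm Gp Gm : Set V → ℝ, Monotone Fp → Monotone Fm → (∀ S, Fm S ≤ Fp S) →
      Monotone Gp → Monotone Gm → (∀ S, Gm S ≤ Gp S) →
      0 ≤ ∑ T ∈ Finset.univ.filter (fun T : Set (Sym2 V) => y ∈ openCluster (T ∩ E) s ∧ u 0 ∉ openCluster (Tᶜ ∩ E) s),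
        (Fp (openCluster (T ∩ E) s) - Fm (openCluster (Tᶜ ∩ E) s)) * (Gp (openCluster (T ∩ E) s) - Gm (openCluster (Tᶜ ∩ E) s)))
    {j : ℕ} (hj : j ≤ a) (Fp Fm Gp Gm : Set V → ℝ) (hFp : Monotone Fp) (hFm : Monotone Fm) (hF : ∀ S, Fm S ≤ Fp S)
    (hGp : Monotone Gp) (hGm : Monotone Gm) (hG : ∀ S, Gm S ≤ Gp S) :
    0 ≤ ∑ T ∈ Finset.univ.filter (fun T : Set (Sym2 V) =>
        y ∈ openCluster (T ∩ (E ∪ Cyc.edgeSet j u)) s ∧ u j ∉ openCluster (Tᶜ ∩ (E ∪ Cyc.edgeSet j u)) s),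
      (Fp (openCluster (T ∩ (E ∪ Cyc.edgeSet j u)) s) - Fm (openCluster (Tᶜ ∩ (E ∪ Cyc.edgeSet j u)) s)) *
        (Gp (openCluster (T ∩ (E ∪ Cyc.edgeSet j u)) s) - Gm (openCluster (Tᶜ ∩ (E ∪ Cyc.edgeSet j u)) s)) := by
  induction j generalizing Fp Fm Gp Gm with
  | zero =>
    rw [Box.union_edgeSet_zero]
    exact hbase Fp Fm Gp Gm hFp hFm hF hGp hGm hG
  | succ j ih =>
    have hj' : j < a := Nat.lt_of_succ_le hj
    rw [Box.union_edgeSet_succ, termTwo_pendant_split_K (Box.leaf_path hfresh huinj hj')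
      (fun h => absurd (huinj j (j + 1) (by omega) hj h) (by omega)) (hsu (j + 1) (Nat.succ_pos j) hj)
      (hyu (j + 1) (Nat.succ_pos j) hj) (fun A B => Fp A - Fm B) (fun A B => Gp A - Gm B)]
    refine add_nonneg (mul_nonneg (by norm_num) ?_) (mul_nonneg (by norm_num) ?_)
    · -- the ⊕-term, with the red argument shifted by `z[Q ∈ ·]`
      have hS : Monotone (fun P : Set V => P ∪ {v | v = u (j + 1) ∧ u j ∈ P}) := by
        intro P P' hPP' v hv
        rcases hv with hv | hv
        · exact Or.inl (hPP' hv)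
        · exact Or.inr ⟨hv.1, hPP' hv.2⟩
      have hFp' : Monotone (fun P : Set V => Fp (P ∪ {v | v = u (j + 1) ∧ u j ∈ P})) := fun P P' hPP' => hFp (hS hPP')
      have hGp' : Monotone (fun P : Set V => Gp (P ∪ {v | v = u (j + 1) ∧ u j ∈ P})) := fun P P' hPP' => hGp (hS hPP')
      exact hoplus j hj' (fun P => Fp (P ∪ {v | v = u (j + 1) ∧ u j ∈ P})) Fm (fun P => Gp (P ∪ {v | v = u (j + 1) ∧ u j ∈ P})) Gm
        hFp' hFm (fun S => (hF S).trans (hFp Set.subset_union_left)) hGp' hGm (fun S => (hG S).trans (hGp Set.subset_union_left))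
    · exact ih (Nat.le_of_succ_le hj) Fp Fm Gp Gm hFp hFm hF hGp hGm hG

end Path

end Pendant

end Antithetic

end Summit.CriticalPhenomena.PercolationContinuityZ3.Theorems
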